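/-
Copyright (c) 2026 the pub-hodgecm-mathlib formalisation cell (harness21).  Prover seat hodgecm-mathlib-F0P3a-p01 (g16): road «S3-ram» (LEAD F0P3a-plan (g12); architect
A-p16 (g31) 22:49:18Z «(a2) SHELL SUMS → p01 GO»; owner F0P3a-p06 (g15)), organ A′ (ii) (a2) part (A): the ALGEBRA of the shell sums; 2026-09-01.
-/
import Mathlib
import HarnessLib

/-!
# The depth-zero κ-transfer at a tame-ramified place, type (1): the SHELL SUMS in closed form (organ A′ (ii) (a2), part (A) — pure algebra)

Topic `NumberTheory/Rogawski1990`; namespace `Literature.NumberTheory.Rogawski1990`.  THEOREMS ONLY (no definition, no instance, no notation, no named fact, no `sorry`);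
kernel lane `--supports stmt-HodgeConjecture-24833`.  Cell `pub/hodgecm-mathlib`, crux H413; road «S3-ram» (Literature seeding, count-neutral), P-1-ram skeleton (architect
A-p16 (g31)) organ A′ (ii): fixed-child criterion ★ p847060 (this seat) → LOCAL TRANSITION LAW (a1) (F0P2-p01 (g15); CERT smoke v1.3 §6) → SHELL SUMS (a2) (this seat) →
κ-sums.  THIS FILE is the tree-free half of (a2): the closed forms of the outward fixed-subtree STRATA VECTORS implied by the local law, and the recursion identities they
satisfy, so that part (B) (the tree induction over (a1)'s heads) closes each inductive step by `exact`.

THE LOCAL LAW (labels `(d, rank Ȳ, class)` of a `t`-fixed self-dual vertex in the nilpotent regime; `q = |𝓀|`; outward fixed children, CERT smoke v1.3 §6 + the parity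
lemma «`J̄₀Ȳ` symmetric for odd `d`, alternating for even `d`» of the 22:51:51Z bus line):
  `E_m = (2m, 2) → q²·O_{m−1}`,  `O_m = (2m+1, 2) → q·E_m + C(q,2)·(P⁺_{m−1} + P⁻_{m−1})`,  `P^±_m = (2m+1, 1, ±) → q²·P^∓_{m−1}`,  `R = O₀ = (1,2) → q·B`,
  `C^± = P^±₀ = (1,1,±)` and `B = (0,2)` LEAVES  (`C(q,2) = q(q−1)∕2` = `(q−1)∕2` outward isotropic lines of each square class × `q` lifts).
STRATA `j ∈ (bd, reg, 1⁺, 1⁻, 0)` (as `Fin 5`): `B ↦ bd`, `R ↦ reg`, `C^± ↦ 1^±`, every `d ≥ 2` label `↦ 0`.  The outward-subtree strata vector `S(label)` (the vertex itself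
included) therefore satisfies `S(B) = e_bd`, `S(R) = e_reg + q·e_bd`, `S(P^±_{m+1}) = e_0 + q²·S(P^∓_m)`, `S(E_{m+1}) = e_0 + q²·S(O_m)`,
`S(O_{m+1}) = e_0 + q·S(E_{m+1}) + C(q,2)·(S(P⁺_m) + S(P⁻_m))`, whose UNIQUE solution is (all sums over `Finset.range`, no subtraction that bites: at `m = 0` the ranges are empty):
  `S(P⁺_m) = (0, 0, [m even]·q^{2m}, [m odd]·q^{2m}, Σ_{i<m} q^{2i})`, `S(P⁻_m)` = the same with `1⁺ ↔ 1⁻`;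
  `S(O_m)   = (q^{3m+1}, q^{3m}, C(q,2)·q^{2m−2}·Σ_{i<m} q^i, same, Σ_{i<m} q^{2i} + Σ_{i<m} q^{2m−1+i})`   (`S(O₀) = S(R) = (q, 1, 0, 0, 0)`);
  `S(E_{m+1}) = (q^{3m+3}, q^{3m+2}, C(q,2)·q^{2m}·Σ_{i<m} q^i, same, Σ_{i≤m} q^{2i} + Σ_{i<m} q^{2m+1+i})`
(e.g. `S(E₁) = (q³, q², 0, 0, 1)`, `S(O₁) = (q⁴, q³, C(q,2), C(q,2), 1 + q)`, `S(E₂) = (q⁶, q⁵, C(q,2)q², C(q,2)q², 1 + q² + q³)`; q = 3 reproduces the certificate chain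
(5,5,5): `(4,2) ×12 → 108 (3,2) → 324 each of (2,2), (1,1,±) → 2916 reg → 8748 bd`).  The class-BLINDNESS `S(·)_{1⁺} = S(·)_{1⁻}` for `E`, `O` is visible (only the `P`-chains
distinguish the classes, by the parity of `m`).  HONEST LABEL: HC_CM is proved only modulo the 2 remaining named inputs (hLiu418 24832, h413 24833) until rung 0 closes;
this file is elementary algebra (identities between explicit natural numbers) and asserts nothing printed; the law table is (a1)'s to prove.

* §1 `geom_sum_sq_succ`, `sum_pow_add_succ` — the telescoping facts (`2·C(q,2) + q = q²` is inlined; it is ★ `Literature.Computability.Complexity.two_mul_choose_two_add`).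
* §2 `shellSum_P_pos_succ` ∕ `shellSum_P_neg_succ` — the `P`-chains.
* §3 `shellSum_E_succ`, `shellSum_O_succ`, `shellSum_O_zero` — the `E`∕`O` chain.

## References
* [Rogawski1990] J. D. Rogawski, *Automorphic Representations of Unitary Groups in Three Variables*, Ann. of Math. Stud. 123 (1990), §4.9 Prop. 4.9.1 (a)(b) p. 55 (the
  transfer whose `G`-side these counts compute).
* [Kottwitz1986] R. E. Kottwitz, *Base change for unit elements of Hecke algebras*, Compositio Math. 60 (1986), §3 (fixed-lattice counts by shells).
* [Serre1980Trees] J.-P. Serre, *Trees* (1980), Ch. II §1.1 (balls and spheres in a regular tree).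
-/

set_option autoImplicit false

namespace Literature.NumberTheory.Rogawski1990

open Finset

/-! ## §1 Two telescoping facts -/

/-- `q²·Σ_{i<m} q^{2i} + 1 = Σ_{i<m} q^{2i} + q^{2m}`. [cite: Serre1980Trees, II.1.1] -/
theorem geom_sum_sq_succ (q m : ℕ) : q ^ 2 * ∑ i ∈ range m, q ^ (2 * i) + 1 = ∑ i ∈ range m, q ^ (2 * i) + q ^ (2 * m) := by
  induction m with
  | zero => simp
  | succ m ih =>
    rw [sum_range_succ, mul_add, add_right_comm, ih]
    ring

/-- `q·Σ_{i<m} q^{a+i} + q^a = Σ_{i<m} q^{a+i} + q^{a+m}`. [cite: Serre1980Trees, II.1.1] -/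
theorem sum_pow_add_succ (q a m : ℕ) : q * ∑ i ∈ range m, q ^ (a + i) + q ^ a = ∑ i ∈ range m, q ^ (a + i) + q ^ (a + m) := by
  induction m with
  | zero => simp
  | succ m ih =>
    rw [sum_range_succ, mul_add, add_right_comm, ih]
    ring

/-! ## §2 The rank-one chains `P^±_m = (2m+1, 1, ±)` (class flips at each step; `P^±₀ = C^±` the collar leaves) -/

/-- **`S(P⁺_{m+1}) = e_0 + q²·S(P⁻_m)`** with the closed forms of the module docstring. [cite: Kottwitz1986, §3] [cite: Serre1980Trees, II.1.1] -/
theorem shellSum_P_pos_succ (q m : ℕ) :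
    (![0, 0, if Even (m + 1) then q ^ (2 * (m + 1)) else 0, if Even (m + 1) then 0 else q ^ (2 * (m + 1)), ∑ i ∈ range (m + 1), q ^ (2 * i)] : Fin 5 → ℕ) =
      ![0, 0, 0, 0, 1] + q ^ 2 • ![0, 0, if Even m then 0 else q ^ (2 * m), if Even m then q ^ (2 * m) else 0, ∑ i ∈ range m, q ^ (2 * i)] := by
  ext j
  fin_cases j
  · simp
  · simp
  · simp only [Nat.even_add_one, Fin.reduceFinMk, Matrix.cons_val, Pi.add_apply, Pi.smul_apply, smul_eq_mul, zero_add]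
    split_ifs <;> ring
  · simp only [Nat.even_add_one, Fin.reduceFinMk, Matrix.cons_val, Pi.add_apply, Pi.smul_apply, smul_eq_mul, zero_add]
    split_ifs <;> ring
  · simp only [Fin.reduceFinMk, Matrix.cons_val, Pi.add_apply, Pi.smul_apply, smul_eq_mul, sum_range_succ, mul_add]
    have h := geom_sum_sq_succ q m
    linarith

/-- **`S(P⁻_{m+1}) = e_0 + q²·S(P⁺_m)`**. [cite: Kottwitz1986, §3] [cite: Serre1980Trees, II.1.1] -/
theorem shellSum_P_neg_succ (q m : ℕ) :
    (![0, 0, if Even (m + 1) then 0 else q ^ (2 * (m + 1)), if Even (m + 1) then q ^ (2 * (m + 1)) else 0, ∑ i ∈ range (m + 1), q ^ (2 * i)] : Fin 5 → ℕ) =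
      ![0, 0, 0, 0, 1] + q ^ 2 • ![0, 0, if Even m then q ^ (2 * m) else 0, if Even m then 0 else q ^ (2 * m), ∑ i ∈ range m, q ^ (2 * i)] := by
  ext j
  fin_cases j
  · simp
  · simp
  · simp only [Nat.even_add_one, Fin.reduceFinMk, Matrix.cons_val, Pi.add_apply, Pi.smul_apply, smul_eq_mul, zero_add]
    split_ifs <;> ring
  · simp only [Nat.even_add_one, Fin.reduceFinMk, Matrix.cons_val, Pi.add_apply, Pi.smul_apply, smul_eq_mul, zero_add]
    split_ifs <;> ring
  · simp only [Fin.reduceFinMk, Matrix.cons_val, Pi.add_apply, Pi.smul_apply, smul_eq_mul, sum_range_succ, mul_add]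
    have h := geom_sum_sq_succ q m
    linarith

/-! ## §3 The rank-two chain `E_m = (2m, 2)`, `O_m = (2m+1, 2)` (`O₀ = R` the regular leaves-but-one, `R → q·B`) -/

/-- `S(O₀) = S(R) = e_reg + q·e_bd`: the closed form of `S(O_m)` at `m = 0` is `(q, 1, 0, 0, 0)`. [cite: Kottwitz1986, §3] -/
theorem shellSum_O_zero (q : ℕ) :
    (![q ^ (3 * 0 + 1), q ^ (3 * 0), q.choose 2 * q ^ (2 * 0 - 2) * ∑ i ∈ range 0, q ^ i, q.choose 2 * q ^ (2 * 0 - 2) * ∑ i ∈ range 0, q ^ i,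
        ∑ i ∈ range 0, q ^ (2 * i) + ∑ i ∈ range 0, q ^ (2 * 0 - 1 + i)] : Fin 5 → ℕ) = ![0, 1, 0, 0, 0] + q • ![1, 0, 0, 0, 0] := by
  ext j; fin_cases j <;> simp

/-- **`S(E_{m+1}) = e_0 + q²·S(O_m)`** with the closed forms of the module docstring. [cite: Kottwitz1986, §3] [cite: Serre1980Trees, II.1.1] -/
theorem shellSum_E_succ (q m : ℕ) :
    (![q ^ (3 * m + 3), q ^ (3 * m + 2), q.choose 2 * q ^ (2 * m) * ∑ i ∈ range m, q ^ i, q.choose 2 * q ^ (2 * m) * ∑ i ∈ range m, q ^ i,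
        ∑ i ∈ range (m + 1), q ^ (2 * i) + ∑ i ∈ range m, q ^ (2 * m + 1 + i)] : Fin 5 → ℕ) =
      ![0, 0, 0, 0, 1] + q ^ 2 • ![q ^ (3 * m + 1), q ^ (3 * m), q.choose 2 * q ^ (2 * m - 2) * ∑ i ∈ range m, q ^ i, q.choose 2 * q ^ (2 * m - 2) * ∑ i ∈ range m, q ^ i,
        ∑ i ∈ range m, q ^ (2 * i) + ∑ i ∈ range m, q ^ (2 * m - 1 + i)] := by
  ext j
  fin_cases j
  · simp only [Fin.reduceFinMk, Matrix.cons_val, Pi.add_apply, Pi.smul_apply, smul_eq_mul, zero_add]; ring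
  · simp only [Fin.reduceFinMk, Matrix.cons_val, Pi.add_apply, Pi.smul_apply, smul_eq_mul, zero_add]; ring
  · simp only [Fin.reduceFinMk, Matrix.cons_val, Pi.add_apply, Pi.smul_apply, smul_eq_mul, zero_add]
    rcases m with _ | m
    · simp
    · rw [show 2 * (m + 1) - 2 = 2 * m by omega]; ring
  · simp only [Fin.reduceFinMk, Matrix.cons_val, Pi.add_apply, Pi.smul_apply, smul_eq_mul, zero_add]
    rcases m with _ | m
    · simp
    · rw [show 2 * (m + 1) - 2 = 2 * m by omega]; ring
  · simp only [Fin.reduceFinMk, Matrix.cons_val, Pi.add_apply, Pi.smul_apply, smul_eq_mul]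
    have h1 := geom_sum_sq_succ q m
    have h3 : q ^ 2 * ∑ i ∈ range m, q ^ (2 * m - 1 + i) = ∑ i ∈ range m, q ^ (2 * m + 1 + i) := by
      rcases m with _ | m
      · simp
      · rw [mul_sum]
        exact sum_congr rfl fun i _ => by rw [← pow_add]; congr 1; omega
    rw [sum_range_succ, mul_add, h3]
    linarith

/-- **`S(O_{m+1}) = e_0 + q·S(E_{m+1}) + C(q,2)·(S(P⁺_m) + S(P⁻_m))`** with the closed forms of the module docstring (the `0`-component is the telescoping
`q² Σ_{i<m} q^{2i} + 1 = Σ_{i<m} q^{2i} + q^{2m}`, `q Σ_{i<m} q^{2m+1+i} + q^{2m+1} = Σ_{i≤m} q^{2m+1+i}` and `2·C(q,2) + q = q²`). [cite: Kottwitz1986, §3] [cite: Serre1980Trees, II.1.1] -/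
theorem shellSum_O_succ (q m : ℕ) :
    (![q ^ (3 * (m + 1) + 1), q ^ (3 * (m + 1)), q.choose 2 * q ^ (2 * (m + 1) - 2) * ∑ i ∈ range (m + 1), q ^ i, q.choose 2 * q ^ (2 * (m + 1) - 2) * ∑ i ∈ range (m + 1), q ^ i,
        ∑ i ∈ range (m + 1), q ^ (2 * i) + ∑ i ∈ range (m + 1), q ^ (2 * (m + 1) - 1 + i)] : Fin 5 → ℕ) =
      ![0, 0, 0, 0, 1] + q • ![q ^ (3 * m + 3), q ^ (3 * m + 2), q.choose 2 * q ^ (2 * m) * ∑ i ∈ range m, q ^ i, q.choose 2 * q ^ (2 * m) * ∑ i ∈ range m, q ^ i,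
          ∑ i ∈ range (m + 1), q ^ (2 * i) + ∑ i ∈ range m, q ^ (2 * m + 1 + i)] +
        q.choose 2 • ((![0, 0, if Even m then q ^ (2 * m) else 0, if Even m then 0 else q ^ (2 * m), ∑ i ∈ range m, q ^ (2 * i)] : Fin 5 → ℕ) +
          ![0, 0, if Even m then 0 else q ^ (2 * m), if Even m then q ^ (2 * m) else 0, ∑ i ∈ range m, q ^ (2 * i)]) := by
  -- `q² = 2·C(q,2) + q` (one inward + one special + `(q−1)∕2` isotropic lines of each class; ★ `Literature.Computability.Complexity.two_mul_choose_two_add` states the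
  -- same identity in an unrelated module — re-derived inline rather than importing the clique-graph file)
  have hC : 2 * q.choose 2 + q = q * q := by
    rcases q with _ | n
    · simp
    · have h := Nat.add_one_mul_choose_eq n 1
      rw [Nat.choose_one_right] at h
      nlinarith [h]
  have h0 : q * ∑ i ∈ range m, q ^ i + 1 = ∑ i ∈ range (m + 1), q ^ i := by
    have h := sum_pow_add_succ q 0 m
    simp only [zero_add, pow_zero] at h
    rw [h, sum_range_succ]
  ext j
  fin_cases j
  · simp only [Fin.reduceFinMk, Matrix.cons_val, Pi.add_apply, Pi.smul_apply, smul_eq_mul, zero_add, add_zero, mul_zero]; ring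
  · simp only [Fin.reduceFinMk, Matrix.cons_val, Pi.add_apply, Pi.smul_apply, smul_eq_mul, zero_add, add_zero, mul_zero]; ring
  · simp only [Fin.reduceFinMk, Matrix.cons_val, Pi.add_apply, Pi.smul_apply, smul_eq_mul, zero_add]
    rw [show 2 * (m + 1) - 2 = 2 * m by omega, ← h0]
    split_ifs <;> simp only [add_zero, zero_add] <;> ring
  · simp only [Fin.reduceFinMk, Matrix.cons_val, Pi.add_apply, Pi.smul_apply, smul_eq_mul, zero_add]
    rw [show 2 * (m + 1) - 2 = 2 * m by omega, ← h0]
    split_ifs <;> simp only [add_zero, zero_add] <;> ring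
  · simp only [Fin.reduceFinMk, Matrix.cons_val, Pi.add_apply, Pi.smul_apply, smul_eq_mul]
    rw [show 2 * (m + 1) - 1 = 2 * m + 1 by omega]
    have h1 := geom_sum_sq_succ q m
    have h2 := sum_pow_add_succ q (2 * m + 1) m
    have hCS : 2 * (q.choose 2 * ∑ i ∈ range m, q ^ (2 * i)) + q * ∑ i ∈ range m, q ^ (2 * i) = q ^ 2 * ∑ i ∈ range m, q ^ (2 * i) := by
      rw [← mul_assoc, ← add_mul, hC]; ring
    have hq : q * q ^ (2 * m) = q ^ (2 * m + 1) := by ring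
    rw [sum_range_succ (fun i => q ^ (2 * i)), sum_range_succ (fun i => q ^ (2 * m + 1 + i))]
    linarith

/-! ## §4 (ED. 2) The rank-one chains WITHOUT class flip — the `χ(−1) = +1` (`q ≡ 1 mod 4`) case (ref5 (g4) R-274: the child class is `χ(−1)`·(parent line value class),
so the ★ §2 rows are the `q ≡ 3 (mod 4)` case; the `E`∕`O` rows only see `S(P⁺) + S(P⁻)`, identical in both variants) -/

/-- **`S(P⁺_{m+1}) = e_0 + q²·S(P⁺_m)` (NO FLIP)** with the class-constant closed form `S(P⁺_m) = (0, 0, q^{2m}, 0, Σ_{i<m} q^{2i})`. [cite: Kottwitz1986, §3] [cite: Serre1980Trees, II.1.1] -/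
theorem shellSum_P_keep_pos_succ (q m : ℕ) :
    (![0, 0, q ^ (2 * (m + 1)), 0, ∑ i ∈ range (m + 1), q ^ (2 * i)] : Fin 5 → ℕ) =
      ![0, 0, 0, 0, 1] + q ^ 2 • ![0, 0, q ^ (2 * m), 0, ∑ i ∈ range m, q ^ (2 * i)] := by
  ext j
  fin_cases j
  · simp
  · simp
  · simp only [Fin.reduceFinMk, Matrix.cons_val, Pi.add_apply, Pi.smul_apply, smul_eq_mul, zero_add]; ring
  · simp
  · simp only [Fin.reduceFinMk, Matrix.cons_val, Pi.add_apply, Pi.smul_apply, smul_eq_mul, sum_range_succ, mul_add]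
    have h := geom_sum_sq_succ q m
    linarith

/-- **`S(P⁻_{m+1}) = e_0 + q²·S(P⁻_m)` (NO FLIP)** with `S(P⁻_m) = (0, 0, 0, q^{2m}, Σ_{i<m} q^{2i})`. [cite: Kottwitz1986, §3] [cite: Serre1980Trees, II.1.1] -/
theorem shellSum_P_keep_neg_succ (q m : ℕ) :
    (![0, 0, 0, q ^ (2 * (m + 1)), ∑ i ∈ range (m + 1), q ^ (2 * i)] : Fin 5 → ℕ) =
      ![0, 0, 0, 0, 1] + q ^ 2 • ![0, 0, 0, q ^ (2 * m), ∑ i ∈ range m, q ^ (2 * i)] := by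
  ext j
  fin_cases j
  · simp
  · simp
  · simp
  · simp only [Fin.reduceFinMk, Matrix.cons_val, Pi.add_apply, Pi.smul_apply, smul_eq_mul, zero_add]; ring
  · simp only [Fin.reduceFinMk, Matrix.cons_val, Pi.add_apply, Pi.smul_apply, smul_eq_mul, sum_range_succ, mul_add]
    have h := geom_sum_sq_succ q m
    linarith

/-- **The `O`-row in the no-flip variant is the same identity**: `S(O_{m+1}) = e_0 + q·S(E_{m+1}) + C(q,2)·(S_keep(P⁺_m) + S_keep(P⁻_m))` — since
`S_keep(P⁺_m) + S_keep(P⁻_m) = (0,0,q^{2m},q^{2m},2Σ_{i<m}q^{2i}) = S(P⁺_m) + S(P⁻_m)`. [cite: Kottwitz1986, §3] [cite: Serre1980Trees, II.1.1] -/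
theorem shellSum_O_succ_keep (q m : ℕ) :
    (![q ^ (3 * (m + 1) + 1), q ^ (3 * (m + 1)), q.choose 2 * q ^ (2 * (m + 1) - 2) * ∑ i ∈ range (m + 1), q ^ i, q.choose 2 * q ^ (2 * (m + 1) - 2) * ∑ i ∈ range (m + 1), q ^ i,
        ∑ i ∈ range (m + 1), q ^ (2 * i) + ∑ i ∈ range (m + 1), q ^ (2 * (m + 1) - 1 + i)] : Fin 5 → ℕ) =
      ![0, 0, 0, 0, 1] + q • ![q ^ (3 * m + 3), q ^ (3 * m + 2), q.choose 2 * q ^ (2 * m) * ∑ i ∈ range m, q ^ i, q.choose 2 * q ^ (2 * m) * ∑ i ∈ range m, q ^ i,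
          ∑ i ∈ range (m + 1), q ^ (2 * i) + ∑ i ∈ range m, q ^ (2 * m + 1 + i)] +
        q.choose 2 • ((![0, 0, q ^ (2 * m), 0, ∑ i ∈ range m, q ^ (2 * i)] : Fin 5 → ℕ) + ![0, 0, 0, q ^ (2 * m), ∑ i ∈ range m, q ^ (2 * i)]) := by
  have hsum : ((![0, 0, q ^ (2 * m), 0, ∑ i ∈ range m, q ^ (2 * i)] : Fin 5 → ℕ) + ![0, 0, 0, q ^ (2 * m), ∑ i ∈ range m, q ^ (2 * i)]) =
      ((![0, 0, if Even m then q ^ (2 * m) else 0, if Even m then 0 else q ^ (2 * m), ∑ i ∈ range m, q ^ (2 * i)] : Fin 5 → ℕ) +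
        ![0, 0, if Even m then 0 else q ^ (2 * m), if Even m then q ^ (2 * m) else 0, ∑ i ∈ range m, q ^ (2 * i)]) := by
    ext j; fin_cases j <;> simp only [Fin.reduceFinMk, Matrix.cons_val, Pi.add_apply] <;> split_ifs <;> simp
  rw [hsum]
  exact shellSum_O_succ q m

end Literature.NumberTheory.Rogawski1990
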